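import Summits.ABC.IUTFork.Thm311RealLinkKits
import Summits.ABC.IUTFork.Thm311RealFullPrintArchChecks
import Literature.IUT.LogThetaLattice.LatticeGlueOfKitsTaggedToy
import HarnessLib

/-!
# [IUTchIII] Theorem 3.11 over real definitions, R6c: NON-VACUITY of the real-link chain (J3/R6) — the kit-frame constructors compose end to end (proof-only)

Record-only file (D-0012) of the abc-iut cell (seat abc-iut-c312-1); TAKES NO SIDE. PROOF-ONLY companion of J3
(`Thm311LinkSmallKits`: `LinkData.ofKitsGlue` over `StripFrame.ofKits` / `LatticeGlue.ofKits` / `LatticeGlue.ofKitsDiagram`) and R6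
(`Thm311RealLinkKits`: `Real.full_statement_honest_realLink`). The cell's rule «vacuity-audit every fork-level hypothesis with a
non-vacuity witness» asks: are the binders of those theorems — a kit stack `L hbij hsurj hR X`, the [IUTchII]-side hypothesis `h`, a
`LatticeGlueKit`, an INJECTIVE family `Hk` of Hodge theaters — jointly satisfiable at all, and do J2/J3's small-model constructors then
produce a `Thm311.LinkData` for which the typed clauses hold? abc-iut-w5-d043's TAGGED TOY kit stack answers the first question in L6
(`LatticeGlueOfKitsTaggedToy`: `KitsTaggedToy.frame : StripFrame.{1}` := `StripFrame.ofKits` over abc-iut-L5-t4's toy kits with tags,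
`KitsTaggedToy.latticeGlue` := `LatticeGlue.ofKits …` with every hypothesis DISCHARGED on the toy, `glueLatticeDiagram kind` :=
`LatticeGlue.ofKitsDiagram …` over the injective tagged family — "the input shape of the Cor 3.12 crew's `Thm311LinkGlue.ofGlue`, at
universe 1"). This file feeds that pair to J3, universe `1` and all:
* `toyKitsLink kind := LinkData.ofGlueSmall KitsTaggedToy.latticeGlue (glueLatticeDiagram kind) (𝟭 _)` — definitionally
  `LinkData.ofKitsGlue` at the tagged toy kits (`toyKitsLink_eq_ofKitsGlue`, `rfl`); (iii)(c)(d) AS TYPED and (IPL) hold for it;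
* **`exists_statement_ofKitsGlue_toyKits`** — CLOSED CERTIFICATE: for every kind and every Θ-pilot divisor assignment there is a
  full situation of Theorem 3.11 whose (iii)-objects ARE `LinkData.ofKitsGlue` over an L6 `…ofKits`-assembled frame (universe `1`) and
  whose typed `Statement` HOLDS, with (IPL) and (SHE)-as-typed — R4c's `ℚ`-pilot datum `PilotData.deepAt ℚ 2 5 …`
  (`Real.full_statement_print_arch`) re-linked by J3's `FullSituation.statement_ofKitsGlue_of_statement`.
HONEST LABEL: TOY kits with tags (consistency / non-vacuity of the constructor chain), NOT genuine Hodge theaters; consistency ≠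
endorsement; instantiated ≠ endorsed; no side taken on [IUTchIII] Cor. 3.12. [claim: Mochizuki2012, status: disputed]
-/

noncomputable section

open Set Function NumberField IsDedekindDomain

namespace Summit.ABC.IUTFork.Thm311

open CategoryTheory Literature.IUT.LogThetaLattice Literature.IUT.HodgeTheaters Literature.IUT.HodgeTheaters.PMBaseKit

variable (l : ℕ) [Fact l.Prime] (hl : l ≠ 2) (kind : LatticeKind)

/-- The tagged toy frame's Hodge-theater category is locally `0`-small (it is `StripFrame.ofKits` over kits in universe `0`; J3
`locallySmall_ofKits_HT`). [folklore] -/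
instance locallySmall_taggedToy_HT : LocallySmall.{0} (KitsTaggedToy.frame l hl).HT := by
  unfold KitsTaggedToy.frame; infer_instance

/-- … and so is its `D`-Hodge-theater category … [folklore] -/
instance locallySmall_taggedToy_DHT : LocallySmall.{0} (KitsTaggedToy.frame l hl).DHT := by
  unfold KitsTaggedToy.frame; infer_instance

/-- … and its `F⊢×μ`-prime-strip category. [folklore] -/
instance locallySmall_taggedToy_Fxm : LocallySmall.{0} (KitsTaggedToy.frame l hl).Fxm := by
  unfold KitsTaggedToy.frame; infer_instance

namespace LinkData

/-- **The (iii)-objects of Thm. 3.11 over the TAGGED TOY kit frame and glue** (universe `1`), through J3's `ofGlueSmall`, with the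
`∞κ` functor `:= 𝟭`. [claim: Mochizuki2012, status: disputed] -/
def toyKitsLink : LinkData :=
  ofGlueSmall (KitsTaggedToy.latticeGlue l hl) (KitsTaggedToy.glueLatticeDiagram l hl kind) (𝟭 _)

/-- `toyKitsLink` IS J3's real-frame constructor `LinkData.ofKitsGlue` applied to the tagged toy kit stack (all of L6's hypotheses
discharged on the toy: `isomFtoDBijective_toyTagged`, `isomFmtoDmSurjective_toyTagged`, `rlfOfIsStrip_toyTagged`,
`fglxmToFxm_mapIso_surjective`, the injective family `thetaPMEllHT`) — definitionally. [folklore] -/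
theorem toyKitsLink_eq_ofKitsGlue :
    toyKitsLink l hl kind =
      ofKitsGlue (FKit.MonoLaws.toyTagged l hl) (FKit.isomFtoDBijective_toyTagged l hl)
        (FKit.isomFmtoDmSurjective_toyTagged l hl) (FKit.rlfOfIsStrip_toyTagged l hl) (KitsTaggedToy.timesMuSide l hl)
        (KitsTaggedToy.fglxmToFxm_mapIso_surjective l hl) (KitsTaggedToy.latticeGlueKit l hl) kind
        (KitsTaggedToy.thetaPMEllHT l hl) (KitsTaggedToy.thetaPMEllHT_injective l hl) (𝟭 _) := rfl

/-- (iii)(c), (iii)(d) AS TYPED and (IPL) hold for the (iii)-objects over the tagged toy kit frame. [folklore] -/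
theorem toyKitsLink_partIIIc_partIIId_ipl :
    (toyKitsLink l hl kind).PartIIIc ∧ (toyKitsLink l hl kind).PartIIId ∧ (toyKitsLink l hl kind).IPL :=
  ⟨(ofGlueSmall_partIIIc_partIIId _ _ _).1, (ofGlueSmall_partIIIc_partIIId _ _ _).2, ofGlueSmall_ipl _ _ _⟩

end LinkData

open Literature.IUT.LogThetaLattice.Witness Real in
/-- **CLOSED CERTIFICATE (non-vacuity of the J3/R6 chain).** For every lattice kind and every Θ-pilot divisor assignment over R4c's
`ℚ`-pilot datum `PilotData.deepAt ℚ 2 5 …` there is a full situation of Theorem 3.11 whose (iii)-objects are `LinkData.ofKitsGlue` over an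
`…ofKits`-assembled frame of universe `1` (the tagged toy kits) and whose typed `Statement` HOLDS, together with (IPL) and (SHE)-as-typed:
R4's `Real.full_statement_print_arch` re-linked by J3's `FullSituation.statement_ofKitsGlue_of_statement`. TOY kits: a consistency witness
for the constructor chain, not an instantiation over real Hodge theaters. [claim: Mochizuki2012, status: disputed] -/
theorem exists_statement_ofKitsGlue_toyKits
    (thetaDiv₀ : ℤ → ℤ → Literature.IUT.LogVolume.LgpDivisor ℚ
      (Real.thetaIndex (PilotData.deepAt ℚ 2 5 Nat.prime_five le_rfl 1 one_pos)).lstar) :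
    ∃ S₀ : LatticeSituation (Real.thetaIndex (PilotData.deepAt ℚ 2 5 Nat.prime_five le_rfl 1 one_pos)),
      (FullSituation.ofKitsGlue (FKit.MonoLaws.toyTagged l hl) (FKit.isomFtoDBijective_toyTagged l hl)
          (FKit.isomFmtoDmSurjective_toyTagged l hl) (FKit.rlfOfIsStrip_toyTagged l hl) (KitsTaggedToy.timesMuSide l hl)
          (KitsTaggedToy.fglxmToFxm_mapIso_surjective l hl) (KitsTaggedToy.latticeGlueKit l hl) kind
          (KitsTaggedToy.thetaPMEllHT l hl) (KitsTaggedToy.thetaPMEllHT_injective l hl) (𝟭 _) S₀).Statement ∧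
      (FullSituation.ofKitsGlue (FKit.MonoLaws.toyTagged l hl) (FKit.isomFtoDBijective_toyTagged l hl)
          (FKit.isomFmtoDmSurjective_toyTagged l hl) (FKit.rlfOfIsStrip_toyTagged l hl) (KitsTaggedToy.timesMuSide l hl)
          (KitsTaggedToy.fglxmToFxm_mapIso_surjective l hl) (KitsTaggedToy.latticeGlueKit l hl) kind
          (KitsTaggedToy.thetaPMEllHT l hl) (KitsTaggedToy.thetaPMEllHT_injective l hl) (𝟭 _) S₀).link.IPL ∧
      (FullSituation.ofKitsGlue (FKit.MonoLaws.toyTagged l hl) (FKit.isomFtoDBijective_toyTagged l hl)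
          (FKit.isomFmtoDmSurjective_toyTagged l hl) (FKit.rlfOfIsStrip_toyTagged l hl) (KitsTaggedToy.timesMuSide l hl)
          (KitsTaggedToy.fglxmToFxm_mapIso_surjective l hl) (KitsTaggedToy.latticeGlueKit l hl) kind
          (KitsTaggedToy.thetaPMEllHT l hl) (KitsTaggedToy.thetaPMEllHT_injective l hl) (𝟭 _) S₀).SHETyped := by
  haveI : Fintype (Real.ArchFibre (PilotData.deepAt ℚ 2 5 Nat.prime_five le_rfl 1 one_pos)) := Fintype.ofFinite _
  have hS := Real.full_statement_print_arch (PilotData.deepAt ℚ 2 5 Nat.prime_five le_rfl 1 one_pos) (fun _ _ => ∅)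
    (fun _ _ _ => 0) (fun _ => ∅) (fun _ _ _ _ => ∅) thetaDiv₀ twoGlue twoLattice (𝟭 (Core twoFrame.DHT)) (fun _ => 0)
    (fun _ _ => 1)
  have hK := FullSituation.statement_ofKitsGlue_of_statement (FKit.MonoLaws.toyTagged l hl)
    (FKit.isomFtoDBijective_toyTagged l hl) (FKit.isomFmtoDmSurjective_toyTagged l hl) (FKit.rlfOfIsStrip_toyTagged l hl)
    (KitsTaggedToy.timesMuSide l hl) (KitsTaggedToy.fglxmToFxm_mapIso_surjective l hl) (KitsTaggedToy.latticeGlueKit l hl)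
    kind (KitsTaggedToy.thetaPMEllHT l hl) (KitsTaggedToy.thetaPMEllHT_injective l hl) (𝟭 _) _ hS
  have hI := LinkData.ofKitsGlue_ipl (FKit.MonoLaws.toyTagged l hl) (FKit.isomFtoDBijective_toyTagged l hl)
    (FKit.isomFmtoDmSurjective_toyTagged l hl) (FKit.rlfOfIsStrip_toyTagged l hl) (KitsTaggedToy.timesMuSide l hl)
    (KitsTaggedToy.fglxmToFxm_mapIso_surjective l hl) (KitsTaggedToy.latticeGlueKit l hl) kind
    (KitsTaggedToy.thetaPMEllHT l hl) (KitsTaggedToy.thetaPMEllHT_injective l hl)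
    (𝟭 (Core (KitsTaggedToy.frame l hl).DHT))
  exact ⟨_, hK, hI, FullSituation.sheTyped_of_statement_of_ipl _ hK hI⟩

end Summit.ABC.IUTFork.Thm311

end
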